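import Summits.ResolutionOfSingularities.ResolutionOfSingularities.Theorems.RadicialJungCleanModelsPBasisDerivation
import Summits.ResolutionOfSingularities.ResolutionOfSingularities.Theorems.RadicialJungCleanModelsPBasisMonomials
import HarnessLib

/-!
# Route `RadicialJung`, crux `CleanModels` (stmt-15917): monomial ideals of a `p`-basis —
# no cancellation between distinct monomial classes (Giraud 1983 §2.6 (6), step (P3) of
# `K2-DESIGN.md` §5.7)

Support file (OURS; general algebra in characteristic `p`) for PROGRAMME-clean-dim2 (K2 step 2.6 =
Giraud's Lemme 2.3 (iii), W8.1). In the proof of Lemme 2.3 (iii) (Bull. SMF 111 (1983), 2.6,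
pp. 119–120) Giraud uses that in the expansion `f = Σ f_{ijb}^p xⁱ yʲ u^b` along differential
coordinates no cancellation occurs between distinct monomial classes: "(6)
`pr + s = ord_M(f − f^p_{000}) = ord_M(x f′_x, y f′_y, f′_{u_i})`", proved from the
`K^p[X^p, Y^p]`-basis `XⁱYʲū^b` of `gr_M(R) = K[X, Y]`. We prove the underlying statement in a
basis-free and grading-free form, for an arbitrary commutative ring `R` of characteristic `p`, a
subset `Γ ⊆ R` (a `p`-basis of `R` over `R^p` in Kimura–Niitsuma's sense in the application) and a
family of derivations `δ_γ` DUAL to `Γ` (`δ_γ γ = 1`, `δ_γ γ′ = 0` for `γ′ ≠ γ`):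

* `monomial_term_mem_of_sum_mem` — **if an ideal `I` is stable under the diagonal operators
  `T_γ = γ δ_γ` (`γ ∈ Γ`), then `Σ_b c_b Γ^b ∈ I` (`c_b ∈ R^p`, `b` reduced) forces every term
  `c_b Γ^b ∈ I`.** Proof: `T_γ(c_b Γ^b) = (b γ) c_b Γ^b` (`mul_derivation_monomial`), two
  distinct classes are separated by some `γ`, the eigenvalue differences `b γ − b′ γ` are units
  (integers of absolute value `< p`), and induction on the number of terms;
* `term_mem_of_mul_derivation_sum_mem` — packaging: `γ₀ δ_{γ₀} (Σ c_b Γ^b) ∈ I` forces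
  `c_b Γ^b ∈ I` for every class `b` with `b γ₀ ≠ 0`;
* `mul_derivation_mem_maximalIdeal`, `mul_derivation_mem_span_monomial_mul` — for a local `R`
  whose maximal ideal is generated by members `x, y` of `Γ`, the ideals `𝔪` and `Γ^b · 𝔪` are
  `T_γ`-stable for every `γ ∈ Γ` (so the theorem applies to `xᵃ𝔪`, `xᵃy𝔪`, …);
* `isUnit_of_coe_ne` — every `γ ∈ Γ ∖ {x, y}` is then a unit (`δ_γ 𝔪 ⊆ 𝔪`, `δ_γ γ = 1`), and
  `exists_monomial_eq_pow_mul_unit` — a monomial `Γ^b` not involving `y` is `x^{b x} ·` unit.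

References: J. Giraud, Bull. SMF 111 (1983), 2.6 (6) [Giraud1983]; T. Kimura, H. Niitsuma, J. Math.
Soc. Japan 32 (1980), p. 363 [KimuraNiitsuma1980]. Nothing here is a statement of Hironaka's
manuscript or bears on the summit directly.
-/

noncomputable section

set_option linter.dupNamespace false -- mandated namespace of this single-conjunct summit

open IsLocalRing Literature.RingTheory.PBasis

namespace Summit.ResolutionOfSingularities.ResolutionOfSingularities.Theorems.RadicialJung.CleanModels

universe u

variable {p : ℕ} [Fact p.Prime] {R : Type u} [CommRing R] [CharP R p]

/-! ## Eigenvalue differences are units -/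

/-- In characteristic `p`, the difference of two distinct natural numbers `< p` is a unit (it is the
image of a nonzero element of the field `ℤ/p`). [folklore] -/
theorem isUnit_natCast_sub_natCast {m n : ℕ} (hm : m < p) (hn : n < p) (hmn : m ≠ n) :
    IsUnit ((m : R) - (n : R)) := by
  have hne : ((m : ZMod p) - (n : ZMod p)) ≠ 0 := by
    intro h
    rw [sub_eq_zero, ZMod.natCast_eq_natCast_iff', Nat.mod_eq_of_lt hm, Nat.mod_eq_of_lt hn] at h
    exact hmn h
  have hu : IsUnit ((m : ZMod p) - (n : ZMod p)) := Ne.isUnit hne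
  simpa using hu.map (ZMod.castHom (dvd_refl p) R)

/-- In particular a nonzero natural number `< p` is a unit. [folklore] -/
theorem isUnit_natCast_of_lt {m : ℕ} (hm : m < p) (hm0 : m ≠ 0) : IsUnit (m : R) := by
  have hp : p.Prime := Fact.out
  simpa using isUnit_natCast_sub_natCast (R := R) hm hp.pos hm0

/-! ## The diagonal operators on finite sums of monomials -/

/-- `γ₀ · D(Σ_{i∈S} c_i Γ^{e i}) = Σ_{i∈S} (e i γ₀) · c_i Γ^{e i}` for a derivation `D` dual to
`γ₀ ∈ Γ` and coefficients `c_i ∈ R^p` (finite-sum form of `mul_derivation_expansion`).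
[cite: Giraud1983, 2.6] -/
theorem mul_derivation_sum_monomial {Γ : Set R} (D : Derivation ℤ R R) (γ₀ : Γ)
    (hD₀ : D (γ₀ : R) = 1) (hD : ∀ γ : Γ, γ ≠ γ₀ → D (γ : R) = 0) {ι : Type*} (S : Finset ι)
    (e : ι → (Γ →₀ ℕ)) (c : ι → (frobenius R p).range) :
    (γ₀ : R) * D (∑ i ∈ S, (c i : R) * (e i).prod fun γ n => ((γ : Γ) : R) ^ n) =
      ∑ i ∈ S, ((e i) γ₀ : R) * ((c i : R) * (e i).prod fun γ n => ((γ : Γ) : R) ^ n) := by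
  rw [map_sum, Finset.mul_sum]
  refine Finset.sum_congr rfl fun i _ => ?_
  rw [derivation_frobenius_mul, mul_left_comm, mul_derivation_monomial D γ₀ hD₀ hD (e i)]
  ring

section Dual

variable {Γ : Set R} (δ : Γ → Derivation ℤ R R) (hδ₁ : ∀ γ : Γ, δ γ (γ : R) = 1)
  (hδ₀ : ∀ γ γ' : Γ, γ' ≠ γ → δ γ (γ' : R) = 0)

/-! ## No cancellation between monomial classes -/

include hδ₁ hδ₀ in
/-- **Monomial ideals: no cancellation between distinct monomial classes.** Let `Γ ⊆ R` carry
derivations `δ_γ` with `δ_γ γ = 1`, `δ_γ γ′ = 0` (`γ′ ≠ γ`), and let `I` be an ideal stable under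
all the operators `v ↦ γ δ_γ v`. If a finite sum `Σ_{b∈S} c_b Γ^b` of `R^p`-multiples of reduced
monomials `Γ^b = ∏ γ^{b γ}` (`b γ < p`, distinct `b`) lies in `I`, then every term `c_b Γ^b` lies
in `I`. (Giraud 1983, 2.6 (6): the order of `f − f^p_{000}` is the minimum of the orders of the
terms of its expansion — here with `I` in place of a power of the maximal ideal.) Proof: apply
`γ δ_γ − μ` for a coordinate `γ` separating two classes; the eigenvalues `b γ − μ` of the other
classes are units. [cite: Giraud1983, 2.6 (6)] -/
theorem monomial_term_mem_of_sum_mem (I : Ideal R) (hI : ∀ γ : Γ, ∀ v ∈ I, (γ : R) * δ γ v ∈ I)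
    (S : Finset {b : Γ →₀ ℕ // ∀ γ, b γ < p})
    (e : {b : Γ →₀ ℕ // ∀ γ, b γ < p} → (frobenius R p).range)
    (h : ∑ b ∈ S, (e b : R) * (b.1).prod (fun γ n => ((γ : Γ) : R) ^ n) ∈ I) :
    ∀ b ∈ S, (e b : R) * (b.1).prod (fun γ n => ((γ : Γ) : R) ^ n) ∈ I := by
  classical
  induction S using Finset.strongInduction generalizing e with
  | H S ih =>
    by_cases hS : ∃ b₁ ∈ S, ∃ b₂ ∈ S, b₁ ≠ b₂
    · obtain ⟨b₁, hb₁, b₂, hb₂, hne⟩ := hS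
      -- a coordinate `γ` separating `b₁` and `b₂`
      obtain ⟨γ, hγ⟩ : ∃ γ, b₁.1 γ ≠ b₂.1 γ := by
        by_contra hcon
        push Not at hcon
        exact hne (Subtype.ext (Finsupp.ext hcon))
      set μ : ℕ := b₁.1 γ with hμ
      set mon : {b : Γ →₀ ℕ // ∀ γ, b γ < p} → R :=
        fun b => (b.1).prod (fun γ n => ((γ : Γ) : R) ^ n) with hmon
      -- apply `γ δ_γ − μ`
      have hT : (γ : R) * δ γ (∑ b ∈ S, (e b : R) * mon b) -
          (μ : R) * ∑ b ∈ S, (e b : R) * mon b ∈ I :=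
        I.sub_mem (hI γ _ h) (I.mul_mem_left _ h)
      rw [hmon, mul_derivation_sum_monomial (δ γ) γ (hδ₁ γ) (hδ₀ γ) S (fun b => b.1) e,
        Finset.mul_sum, ← Finset.sum_sub_distrib] at hT
      -- the new coefficients
      let e' : {b : Γ →₀ ℕ // ∀ γ, b γ < p} → (frobenius R p).range := fun b =>
        ⟨(((b.1 γ : ℕ) : R) - (μ : R)) * (e b : R),
          Subring.mul_mem _ (Subring.sub_mem _ (natCast_mem _ _) (natCast_mem _ _)) (e b).2⟩
      have hsum : ∑ b ∈ S, (((b.1 γ : ℕ) : R) * ((e b : R) * mon b) -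
            (μ : R) * ((e b : R) * mon b)) =
          ∑ b ∈ S.filter (fun b => b.1 γ ≠ μ), (e' b : R) * mon b := by
        rw [Finset.sum_filter]
        refine Finset.sum_congr rfl fun b _ => ?_
        split_ifs with hb
        · simp only [e']; ring
        · push Not at hb
          rw [hb, sub_self]
      rw [hsum] at hT
      -- the classes with `b γ ≠ μ`: strictly fewer, and the eigenvalue difference is a unit
      have hsub : S.filter (fun b => b.1 γ ≠ μ) ⊂ S :=
        Finset.filter_ssubset.mpr ⟨b₁, hb₁, by rw [hμ]; exact fun h => h rfl⟩
      have ih1 := ih _ hsub e' hT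
      have hfil : ∀ b ∈ S, b.1 γ ≠ μ → (e b : R) * mon b ∈ I := by
        intro b hb hbγ
        have hmem := ih1 b (Finset.mem_filter.mpr ⟨hb, hbγ⟩)
        have hu : IsUnit (((b.1 γ : ℕ) : R) - (μ : R)) :=
          isUnit_natCast_sub_natCast (b.2 γ) (b₁.2 γ) hbγ
        have hmem' : (((b.1 γ : ℕ) : R) - (μ : R)) * ((e b : R) * mon b) ∈ I := by
          have : (e' b : R) * mon b = (((b.1 γ : ℕ) : R) - (μ : R)) * ((e b : R) * mon b) := by
            simp only [e']; ring
          rw [← this]; exact hmem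
        exact (Ideal.unit_mul_mem_iff_mem I hu).mp hmem'
      -- the classes with `b γ = μ`: also strictly fewer (`b₂` is missing)
      have hrest : ∑ b ∈ S.filter (fun b => b.1 γ = μ), (e b : R) * mon b ∈ I := by
        have hsplit := Finset.sum_filter_add_sum_filter_not S (fun b => b.1 γ = μ)
          (fun b => (e b : R) * mon b)
        rw [← hsplit] at h
        have hB : ∑ b ∈ S.filter (fun b => ¬ b.1 γ = μ), (e b : R) * mon b ∈ I :=
          I.sum_mem fun b hb => by
            obtain ⟨hb1, hb2⟩ := Finset.mem_filter.mp hb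
            exact hfil b hb1 hb2
        exact (I.add_mem_iff_left hB).mp h
      have hsub2 : S.filter (fun b => b.1 γ = μ) ⊂ S :=
        Finset.filter_ssubset.mpr ⟨b₂, hb₂, by rw [hμ]; exact fun h => hγ h.symm⟩
      have ih2 := ih _ hsub2 e hrest
      intro b hb
      by_cases hbγ : b.1 γ = μ
      · exact ih2 b (Finset.mem_filter.mpr ⟨hb, hbγ⟩)
      · exact hfil b hb hbγ
    · -- at most one class
      push Not at hS
      intro b hb
      have hS1 : S = {b} :=
        Finset.eq_singleton_iff_unique_mem.mpr ⟨hb, fun b' hb' => hS b' hb' b hb⟩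
      rw [hS1, Finset.sum_singleton] at h
      exact h

include hδ₁ hδ₀ in
/-- **Packaging for one coordinate.** If `I` is stable under the `γ δ_γ` and
`γ₀ δ_{γ₀} (Σ_{b∈S} c_b Γ^b) ∈ I`, then `c_b Γ^b ∈ I` for every class `b ∈ S` with `b γ₀ ≠ 0`
(the operator `γ₀δ_{γ₀}` multiplies the class `b` by the unit `b γ₀`). [cite: Giraud1983, 2.6 (6)] -/
theorem term_mem_of_mul_derivation_sum_mem (I : Ideal R)
    (hI : ∀ γ : Γ, ∀ v ∈ I, (γ : R) * δ γ v ∈ I) (γ₀ : Γ)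
    (S : Finset {b : Γ →₀ ℕ // ∀ γ, b γ < p})
    (e : {b : Γ →₀ ℕ // ∀ γ, b γ < p} → (frobenius R p).range)
    (h : (γ₀ : R) * δ γ₀ (∑ b ∈ S, (e b : R) * (b.1).prod (fun γ n => ((γ : Γ) : R) ^ n)) ∈ I) :
    ∀ b ∈ S, b.1 γ₀ ≠ 0 → (e b : R) * (b.1).prod (fun γ n => ((γ : Γ) : R) ^ n) ∈ I := by
  rw [mul_derivation_sum_monomial (δ γ₀) γ₀ (hδ₁ γ₀) (hδ₀ γ₀) S (fun b => b.1) e] at h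
  let e' : {b : Γ →₀ ℕ // ∀ γ, b γ < p} → (frobenius R p).range := fun b =>
    ⟨((b.1 γ₀ : ℕ) : R) * (e b : R), Subring.mul_mem _ (natCast_mem _ _) (e b).2⟩
  have hsum : ∑ b ∈ S, ((b.1 γ₀ : ℕ) : R) *
        ((e b : R) * (b.1).prod (fun γ n => ((γ : Γ) : R) ^ n)) =
      ∑ b ∈ S, (e' b : R) * (b.1).prod (fun γ n => ((γ : Γ) : R) ^ n) :=
    Finset.sum_congr rfl fun b _ => by simp only [e']; ring
  rw [hsum] at h
  intro b hb hb0
  have hmem := monomial_term_mem_of_sum_mem δ hδ₁ hδ₀ I hI S e' h b hb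
  have hu : IsUnit ((b.1 γ₀ : ℕ) : R) := isUnit_natCast_of_lt (b.2 γ₀) hb0
  have hmem' : ((b.1 γ₀ : ℕ) : R) *
      ((e b : R) * (b.1).prod (fun γ n => ((γ : Γ) : R) ^ n)) ∈ I := by
    have : (e' b : R) * (b.1).prod (fun γ n => ((γ : Γ) : R) ^ n) =
        ((b.1 γ₀ : ℕ) : R) * ((e b : R) * (b.1).prod (fun γ n => ((γ : Γ) : R) ^ n)) := by
      simp only [e']; ring
    rw [← this]; exact hmem
  exact (Ideal.unit_mul_mem_iff_mem I hu).mp hmem'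

/-! ## Stable ideals when the maximal ideal is generated by members of `Γ` -/

omit [Fact p.Prime] [CharP R p] in
/-- A derivation killing a generating set of an ideal maps the ideal into itself. [folklore] -/
theorem derivation_apply_mem_span_of_forall_eq_zero (D : Derivation ℤ R R) {G : Set R}
    (hG : ∀ g ∈ G, D g = 0) {v : R} (hv : v ∈ Ideal.span G) : D v ∈ Ideal.span G := by
  induction hv using Submodule.span_induction with
  | mem g hg => rw [hG g hg]; exact Ideal.zero_mem _
  | zero => rw [map_zero]; exact Ideal.zero_mem _
  | add a b _ _ ha hb => rw [map_add]; exact Ideal.add_mem _ ha hb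
  | smul r a ha iha =>
    rw [smul_eq_mul, D.leibniz, smul_eq_mul, smul_eq_mul]
    exact Ideal.add_mem _ (Ideal.mul_mem_left _ _ iha) (Ideal.mul_mem_right _ _ ha)

variable [IsLocalRing R] {x y : R} (hx : x ∈ Γ) (hy : y ∈ Γ)
  (hm : maximalIdeal R = Ideal.span {x, y})

include hδ₀ hx hy hm in
/-- For `γ ∈ Γ ∖ {x, y}`, `δ_γ` kills `x` and `y`, hence preserves `𝔪 = (x, y)`. [folklore] -/
theorem derivation_apply_mem_maximalIdeal_of_ne (γ : Γ) (hγx : (γ : R) ≠ x) (hγy : (γ : R) ≠ y)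
    {v : R} (hv : v ∈ maximalIdeal R) : δ γ v ∈ maximalIdeal R := by
  rw [hm] at hv ⊢
  refine derivation_apply_mem_span_of_forall_eq_zero (δ γ) (fun g hg => ?_) hv
  simp only [Set.mem_insert_iff, Set.mem_singleton_iff] at hg
  rcases hg with rfl | rfl
  · exact hδ₀ γ ⟨g, hx⟩ (fun h => hγx (by rw [← h]))
  · exact hδ₀ γ ⟨g, hy⟩ (fun h => hγy (by rw [← h]))

include hδ₀ hx hy hm in
/-- **`𝔪` is stable under every `γ δ_γ`** (`γ ∈ 𝔪` for `γ ∈ {x, y}`, `δ_γ 𝔪 ⊆ 𝔪` otherwise).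
[folklore] -/
theorem mul_derivation_mem_maximalIdeal (γ : Γ) {v : R} (hv : v ∈ maximalIdeal R) :
    (γ : R) * δ γ v ∈ maximalIdeal R := by
  by_cases hγx : (γ : R) = x
  · rw [hγx]
    exact Ideal.mul_mem_right _ _ (hm ▸ Ideal.subset_span (by simp))
  by_cases hγy : (γ : R) = y
  · rw [hγy]
    exact Ideal.mul_mem_right _ _ (hm ▸ Ideal.subset_span (by simp))
  exact Ideal.mul_mem_left _ _
    (derivation_apply_mem_maximalIdeal_of_ne δ hδ₀ hx hy hm γ hγx hγy hv)

include hδ₁ hδ₀ hx hy hm in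
/-- **`Γ^b · 𝔪` is stable under every `γ δ_γ`** (`γδ_γ(Γ^b m) = (bγ)Γ^b m + Γ^b γδ_γ m`), for
every (not necessarily reduced) exponent `b`; e.g. `xᵃ𝔪`, `xᵃy𝔪`. [folklore] -/
theorem mul_derivation_mem_span_monomial_mul (b : Γ →₀ ℕ) (γ : Γ) {v : R}
    (hv : v ∈ Ideal.span {b.prod fun γ n => ((γ : Γ) : R) ^ n} * maximalIdeal R) :
    (γ : R) * δ γ v ∈ Ideal.span {b.prod fun γ n => ((γ : Γ) : R) ^ n} * maximalIdeal R := by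
  obtain ⟨m, hmm, rfl⟩ := Ideal.mem_span_singleton_mul.mp hv
  set s := b.prod fun γ n => ((γ : Γ) : R) ^ n with hs
  have e1 : (γ : R) * δ γ (s * m) = s * ((γ : R) * δ γ m) + m * ((γ : R) * δ γ s) := by
    rw [Derivation.leibniz, smul_eq_mul, smul_eq_mul]; ring
  rw [e1, hs, mul_derivation_monomial (δ γ) γ (hδ₁ γ) (hδ₀ γ) b]
  refine Ideal.add_mem _ (Ideal.mul_mem_mul (Ideal.mem_span_singleton_self _)
    (mul_derivation_mem_maximalIdeal δ hδ₀ hx hy hm γ hmm)) ?_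
  have e2 : m * ((b γ : R) * b.prod fun γ n => ((γ : Γ) : R) ^ n) =
      (b.prod fun γ n => ((γ : Γ) : R) ^ n) * ((b γ : R) * m) := by ring
  rw [e2]
  exact Ideal.mul_mem_mul (Ideal.mem_span_singleton_self _) (Ideal.mul_mem_left _ _ hmm)

include hδ₁ hδ₀ hx hy hm in
/-- **Every `γ ∈ Γ ∖ {x, y}` is a unit**: otherwise `γ ∈ 𝔪` and `1 = δ_γ γ ∈ δ_γ 𝔪 ⊆ 𝔪`.
[folklore] -/
theorem isUnit_of_coe_ne (γ : Γ) (hγx : (γ : R) ≠ x) (hγy : (γ : R) ≠ y) : IsUnit (γ : R) := by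
  by_contra hu
  have hγm : (γ : R) ∈ maximalIdeal R := (mem_maximalIdeal _).mpr hu
  have h1 := derivation_apply_mem_maximalIdeal_of_ne δ hδ₀ hx hy hm γ hγx hγy hγm
  rw [hδ₁ γ] at h1
  exact (maximalIdeal.isMaximal R).ne_top ((Ideal.eq_top_iff_one _).mpr h1)

include hδ₁ hδ₀ hx hy hm in
/-- A monomial `Γ^b` not involving `y` is `x^{b x}` times a unit. [folklore] -/
theorem exists_monomial_eq_pow_mul_unit (b : Γ →₀ ℕ) (hby : b ⟨y, hy⟩ = 0) :
    ∃ U : R, IsUnit U ∧ (b.prod fun γ n => ((γ : Γ) : R) ^ n) = x ^ (b ⟨x, hx⟩) * U := by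
  classical
  have hunit : ∀ γ ∈ (b.erase ⟨x, hx⟩).support,
      IsUnit (((γ : Γ) : R) ^ (b.erase ⟨x, hx⟩) γ) := by
    intro γ hγ
    rw [Finsupp.support_erase, Finset.mem_erase] at hγ
    refine IsUnit.pow _ (isUnit_of_coe_ne δ hδ₁ hδ₀ hx hy hm γ
      (fun h => hγ.1 (Subtype.ext h)) ?_)
    intro h
    have : γ = ⟨y, hy⟩ := Subtype.ext h
    rw [this, Finsupp.mem_support_iff] at hγ
    exact hγ.2 hby
  by_cases hxb : (⟨x, hx⟩ : Γ) ∈ b.support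
  · refine ⟨(b.erase ⟨x, hx⟩).prod fun γ n => ((γ : Γ) : R) ^ n, ?_, ?_⟩
    · exact IsUnit.prod_iff.mpr hunit
    · rw [← Finsupp.mul_prod_erase b ⟨x, hx⟩ (fun γ n => ((γ : Γ) : R) ^ n) hxb]
  · have hb0 : b ⟨x, hx⟩ = 0 := Finsupp.notMem_support_iff.mp hxb
    refine ⟨b.prod fun γ n => ((γ : Γ) : R) ^ n, ?_, by rw [hb0, pow_zero, one_mul]⟩
    have hbe : b.erase ⟨x, hx⟩ = b := by
      ext γ
      by_cases h : γ = ⟨x, hx⟩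
      · rw [h, Finsupp.erase_same, hb0]
      · rw [Finsupp.erase_ne h]
    rw [← hbe]
    exact IsUnit.prod_iff.mpr hunit

end Dual

end Summit.ResolutionOfSingularities.ResolutionOfSingularities.Theorems.RadicialJung.CleanModels

end
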